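import Literature.NumberTheory.Transcendental.RoySmallValueEstimatesAlgPointLiouvilleProofs
import HarnessLib

/-!
# Route `RoyCriterion`, crux `NguyenRoySmallValueTranslates` (stmt-Schanuel-1051), line `Sketch`
# — stub `stub_liouvilleConjSum`

Registered stub H of the skeleton of line `Sketch` for the crux
`Summit.Schanuel.Schanuel.Theses.RoyCriterion.NguyenRoySmallValueTranslates`: **Proposition 12 of
Nguyen–Roy 2016 in its printed SUM form.** For two algebraic points `P, P'` of `ℙ²(ℂ)` (classes of
conjugates `conj P`, `conj P'` = the points of two zero-dimensional `ℚ`-subvarieties `Z, Z*`) and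
ANY finite set `A` of pairs of DISTINCT points `(q, q') ∈ conj P × conj P'`,
`∑_{(q,q') ∈ A} log dist(q, q') ≥ −(log 2 · deg P · deg P' + deg P · ht P' + deg P' · ht P)`,
the same budget as for one pair (`AlgPt.liouville_conj`, in tree).

Proof (as printed, arXiv:1412.5163 p. 10). A pair `(q, q') = ([φ(ap P)], [φ'(ap P')])` is given
by a pair of embeddings `(φ, φ')` of `ℚ(P)`, `ℚ(P')`; let `L = ℚ(φ(ap P), φ'(ap P')) ⊆ ℂ` be the
compositum and `γ, δ ∈ L³` the two coordinate vectors. The embeddings `σ : L → ℂ` act on the pair,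
`σ · (φ, φ') = (σ ∘ φ, σ ∘ φ')`, injectively (a coordinate of `ap` is `1` and the coordinates
generate `L`), so the orbit has `[L:ℚ]` elements; orbits are equal or disjoint (if `(ψ, ψ')` is in
the orbit of `(φ, φ')` through `σ`, then `σ(L) ⊆ L_{(ψ,ψ')}`, the orbit of `(ψ, ψ')` is contained in
that of `(φ, φ')` and `[L:ℚ] ≤ [L_{(ψ,ψ')}:ℚ]`, whence equality by counting). On one orbit the
tree's diophantine core `NguyenRoy.neg_logHeight_le_sum_log_projDist` (any finite set of
embeddings of `L`) with `h_L(γ) = [L:ℚ] h_abs(P)`, `h_L(δ) = [L:ℚ] h_abs(P')` gives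
`∑_{A ∩ orbit} log dist ≥ −[L:ℚ] (h_abs(P) + h_abs(P') + log 2)`; summing over the orbits meeting
`A` (a combinatorial lemma, `neg_card_mul_le_sum_of_classes`) and `∑ |orbit| ≤ deg P · deg P'`
gives the claim, since `ht = deg · h_abs`.

## References

* [NguyenRoy2016] N. A. V. Nguyen, D. Roy, IJNT 12 (2016) 1273–1293 = arXiv:1412.5163, §4,
  Proposition 12 and its proof.
-/

-- `Summit.Schanuel.Schanuel.…` is the mandated layout of this single-problem summit (CONVENTIONS §1).
set_option linter.dupNamespace false

noncomputable section

open Filter Finset Module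
open scoped Classical

namespace Summit.Schanuel.Schanuel.Theorems.NguyenRoySharp

open Literature.NumberTheory.Transcendental
open Literature.NumberTheory.Transcendental.NguyenRoy

/-! ### Ring homomorphisms out of a field generated by a set -/

/-- A ring homomorphism out of `ℚ(S) ⊆ ℂ` maps `ℚ(S)` into any subfield of `ℂ` containing the
images of the generators. [folklore] -/
theorem ringHom_map_mem_of_gens {K T : IntermediateField ℚ ℂ} {S : Set ℂ}
    (hK : K = IntermediateField.adjoin ℚ S) (σ : K →+* ℂ)
    (h : ∀ x (hx : x ∈ S), σ ⟨x, hK.ge (IntermediateField.subset_adjoin ℚ S hx)⟩ ∈ T)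
    (z : K) : σ z ∈ T := by
  subst hK
  obtain ⟨z, hz⟩ := z
  induction hz using IntermediateField.adjoin_induction with
  | mem x hx => exact h x hx
  | algebraMap q =>
      rw [show (⟨algebraMap ℚ ℂ q, IntermediateField.algebraMap_mem _ q⟩ :
          IntermediateField.adjoin ℚ S) = (q : IntermediateField.adjoin ℚ S) from
        Subtype.ext (by simp), map_ratCast]
      simpa only [eq_ratCast] using IntermediateField.algebraMap_mem T q
  | add x y hx hy ihx ihy =>
      have e : (⟨x + y, add_mem hx hy⟩ : IntermediateField.adjoin ℚ S) = ⟨x, hx⟩ + ⟨y, hy⟩ := rfl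
      rw [e, map_add]
      exact add_mem ihx ihy
  | inv x hx ihx =>
      have e : (⟨x⁻¹, inv_mem hx⟩ : IntermediateField.adjoin ℚ S) = ⟨x, hx⟩⁻¹ := rfl
      rw [e, map_inv₀]
      exact inv_mem ihx
  | mul x y hx hy ihx ihy =>
      have e : (⟨x * y, mul_mem hx hy⟩ : IntermediateField.adjoin ℚ S) = ⟨x, hx⟩ * ⟨y, hy⟩ := rfl
      rw [e, map_mul]
      exact mul_mem ihx ihy

/-- Two ring homomorphisms out of `ℚ(S) ⊆ ℂ` which agree on `S` are equal. [folklore] -/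
theorem ringHom_ext_of_gens {K : IntermediateField ℚ ℂ} {S : Set ℂ}
    (hK : K = IntermediateField.adjoin ℚ S) {σ τ : K →+* ℂ}
    (h : ∀ x (hx : x ∈ S), σ ⟨x, hK.ge (IntermediateField.subset_adjoin ℚ S hx)⟩ =
      τ ⟨x, hK.ge (IntermediateField.subset_adjoin ℚ S hx)⟩) : σ = τ := by
  have key : σ.toRatAlgHom = τ.toRatAlgHom :=
    IntermediateField.algHom_ext_of_eq_adjoin ℚ hK fun x hx => h x hx
  exact RingHom.ext fun z => DFunLike.congr_fun key z

/-- If `σ : L₁ → ℂ` takes values in the finite extension `L₂ ⊆ ℂ` of `ℚ`, then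
`[L₁:ℚ] ≤ [L₂:ℚ]`. [folklore] -/
theorem finrank_le_of_ringHom_mem {L₁ L₂ : IntermediateField ℚ ℂ} [FiniteDimensional ℚ L₂]
    (σ : L₁ →+* ℂ) (hσ : ∀ z, σ z ∈ L₂) : finrank ℚ L₁ ≤ finrank ℚ L₂ :=
  LinearMap.finrank_le_finrank_of_injective
    (f := (σ.codRestrict L₂ hσ).toRatAlgHom.toLinearMap)
    fun _ _ hab => (σ.codRestrict L₂ hσ).injective hab

/-! ### The action of the embeddings of a compositum on pairs of embeddings -/

/-- The pair of embeddings `(σ ∘ f, σ ∘ f')` determines `σ` on the field generated by the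
coordinates of `f(ap P)` and `f'(ap P')`. [cite: NguyenRoy2016, §4 (proof of Proposition 12)] -/
theorem pairOrbit_act_injective (P P' : AlgPt) {L : IntermediateField ℚ ℂ} {S : Set ℂ}
    (hL : L = IntermediateField.adjoin ℚ S) (f : Kp P.1 →+* L) (f' : Kp P'.1 →+* L)
    (hS : S ⊆ Set.range (fun j => ((f (ap P.1 j) : L) : ℂ)) ∪
      Set.range (fun j => ((f' (ap P'.1 j) : L) : ℂ))) :
    Function.Injective fun σ : L →+* ℂ => ((σ.comp f).toRatAlgHom, (σ.comp f').toRatAlgHom) := by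
  intro σ τ h
  simp only [Prod.mk.injEq] at h
  refine ringHom_ext_of_gens hL fun x hx => ?_
  rcases hS hx with ⟨j, rfl⟩ | ⟨j, rfl⟩
  · exact DFunLike.congr_fun h.1 (ap P.1 j)
  · exact DFunLike.congr_fun h.2 (ap P'.1 j)

/-- Transport along `σ`: if `σ : L₁ → ℂ` takes values in `L₂` and `f₂ = σ ∘ f₁`, `f₂' = σ ∘ f₁'`,
then every pair `(τ ∘ f₂, τ ∘ f₂')`, `τ : L₂ → ℂ`, is the pair `(ρ ∘ f₁, ρ ∘ f₁')` for
`ρ = τ ∘ σ : L₁ → ℂ`. [cite: NguyenRoy2016, §4 (proof of Proposition 12: the orbits)] -/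
theorem pairOrbit_act_transport {R R' : Type*} [Field R] [Algebra ℚ R] [Field R']
    [Algebra ℚ R'] {L₁ L₂ : IntermediateField ℚ ℂ} (σ : L₁ →+* ℂ) (hσ : ∀ z, σ z ∈ L₂)
    (f₁ : R →+* L₁) (f₁' : R' →+* L₁) (f₂ : R →+* L₂) (f₂' : R' →+* L₂)
    (hf : ∀ x, ((f₂ x : L₂) : ℂ) = σ (f₁ x)) (hf' : ∀ x, ((f₂' x : L₂) : ℂ) = σ (f₁' x))
    (τ : L₂ →+* ℂ) :
    ∃ ρ : L₁ →+* ℂ, (ρ.comp f₁).toRatAlgHom = (τ.comp f₂).toRatAlgHom ∧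
      (ρ.comp f₁').toRatAlgHom = (τ.comp f₂').toRatAlgHom := by
  refine ⟨τ.comp (σ.codRestrict L₂ hσ), AlgHom.ext fun x => ?_, AlgHom.ext fun x => ?_⟩
  · exact congrArg τ (Subtype.ext (hf x).symm : σ.codRestrict L₂ hσ (f₁ x) = f₂ x)
  · exact congrArg τ (Subtype.ext (hf' x).symm : σ.codRestrict L₂ hσ (f₁' x) = f₂' x)

/-- The field `ℚ(φ(ap P), φ'(ap P')) ⊆ ℂ` generated by the coordinates of a pair of conjugates
contains `φ(ℚ(P))` and `φ'(ℚ(P'))`. [folklore] -/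
theorem map_mem_adjoin_pair (P P' : AlgPt) (φ : Kp P.1 →ₐ[ℚ] ℂ) (φ' : Kp P'.1 →ₐ[ℚ] ℂ) :
    (∀ x, φ x ∈ IntermediateField.adjoin ℚ
        (Set.range (fun j => φ (ap P.1 j)) ∪ Set.range (fun j => φ' (ap P'.1 j)))) ∧
      ∀ x, φ' x ∈ IntermediateField.adjoin ℚ
        (Set.range (fun j => φ (ap P.1 j)) ∪ Set.range (fun j => φ' (ap P'.1 j))) := by
  constructor
  · intro x
    refine ringHom_map_mem_of_gens (K := Kp P.1) (S := Set.range (nv P.1)) rfl φ.toRingHom ?_ x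
    rintro _ ⟨j, rfl⟩
    exact IntermediateField.subset_adjoin ℚ _ (Or.inl ⟨j, rfl⟩)
  · intro x
    refine ringHom_map_mem_of_gens (K := Kp P'.1) (S := Set.range (nv P'.1)) rfl φ'.toRingHom ?_ x
    rintro _ ⟨j, rfl⟩
    exact IntermediateField.subset_adjoin ℚ _ (Or.inr ⟨j, rfl⟩)

/-- `ℚ(φ(ap P), φ'(ap P'))` is a number field. [folklore] -/
theorem numberField_adjoin_pair (P P' : AlgPt) (φ : Kp P.1 →ₐ[ℚ] ℂ) (φ' : Kp P'.1 →ₐ[ℚ] ℂ) :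
    NumberField (IntermediateField.adjoin ℚ
      (Set.range (fun j => φ (ap P.1 j)) ∪ Set.range (fun j => φ' (ap P'.1 j)))) := by
  haveI : FiniteDimensional ℚ (IntermediateField.adjoin ℚ
      (Set.range (fun j => φ (ap P.1 j)) ∪ Set.range (fun j => φ' (ap P'.1 j)))) := by
    apply IntermediateField.finiteDimensional_adjoin
    rintro x (⟨j, rfl⟩ | ⟨j, rfl⟩)
    · exact (Algebra.IsIntegral.isIntegral (R := ℚ) (ap P.1 j)).map φ
    · exact (Algebra.IsIntegral.isIntegral (R := ℚ) (ap P'.1 j)).map φ'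
  exact NFPres.numberField_of_intermediateField _

/-! ### Liouville on one orbit -/

/-- `γ ∧ δ ≠ 0` when the points `[γ] ≠ [δ]` are distinct. [folklore] -/
theorem wedge_ne_zero_of_mk_ne {L : IntermediateField ℚ ℂ} {γ δ : Fin 3 → L} (hγ : γ ≠ 0)
    (hδ : δ ≠ 0)
    (h : Projectivization.mk ℂ (fun j => algebraMap L ℂ (γ j)) (map_vec_ne_zero _ hγ) ≠
      Projectivization.mk ℂ (fun j => algebraMap L ℂ (δ j)) (map_vec_ne_zero _ hδ)) :
    wedge γ δ ≠ 0 := by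
  intro hw0
  apply h
  apply mk_eq_mk_of_wedge_eq_zero
  funext p
  have := map_wedge (algebraMap L ℂ) γ δ p
  rw [hw0, Pi.zero_apply, map_zero] at this
  rw [Pi.zero_apply]
  exact this.symm

/-- **Liouville on part of an orbit** (the diophantine core of Proposition 12 for the vectors
`γ, δ ∈ L³` over a number field `L ⊆ ℂ` and any finite set `S` of embeddings of `L` at which the
points `[σγ] ≠ [σδ]`): `−[L:ℚ] (h_abs[γ] + h_abs[δ] + log 2) ≤ ∑_{σ ∈ S} log dist([σγ], [σδ])`.
[cite: NguyenRoy2016, Proposition 12 (proof)] -/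
theorem pairOrbit_liouville (L : IntermediateField ℚ ℂ) [NumberField L] {γ δ : Fin 3 → L}
    (hγ : γ ≠ 0) (hδ : δ ≠ 0) (hw : wedge γ δ ≠ 0) (S : Finset (L →+* ℂ))
    (hS : ∀ σ ∈ S, Projectivization.mk ℂ (fun j => σ (γ j)) (map_vec_ne_zero σ hγ) ≠
      Projectivization.mk ℂ (fun j => σ (δ j)) (map_vec_ne_zero σ hδ)) :
    -((finrank ℚ L : ℝ) *
        (habs (Projectivization.mk ℂ (fun j => algebraMap L ℂ (γ j)) (map_vec_ne_zero _ hγ)) +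
          habs (Projectivization.mk ℂ (fun j => algebraMap L ℂ (δ j)) (map_vec_ne_zero _ hδ)) +
          Real.log 2)) ≤
      ∑ σ ∈ S, Real.log (pdist (Projectivization.mk ℂ (fun j => σ (γ j)) (map_vec_ne_zero σ hγ))
        (Projectivization.mk ℂ (fun j => σ (δ j)) (map_vec_ne_zero σ hδ))) := by
  have hdist : ∀ σ : L →+* ℂ,
      pdist (Projectivization.mk ℂ (fun j => σ (γ j)) (map_vec_ne_zero σ hγ))
        (Projectivization.mk ℂ (fun j => σ (δ j)) (map_vec_ne_zero σ hδ)) =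
      Nesterenko.projDist (σ ∘ γ) (σ ∘ δ) := fun σ => pdist_mk _ _
  have hL := neg_logHeight_le_sum_log_projDist hw S (fun σ hσ => by
    rw [← hdist]; exact (pdist_pos_of_ne (hS σ hσ)).ne')
  simp_rw [hdist]
  rw [habs_mk, habs_mk]
  have hpos : (0 : ℝ) < finrank ℚ L := by exact_mod_cast Module.finrank_pos
  have e : (finrank ℚ L : ℝ) * (Height.logHeight γ / finrank ℚ L +
      Height.logHeight δ / finrank ℚ L + Real.log 2) =
      Height.logHeight γ + Height.logHeight δ + finrank ℚ L * Real.log 2 := by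
    field_simp
  linarith

/-! ### The class bound: a combinatorial lemma -/

/-- **Summing a per-class bound over classes.** Let `cls x ⊆ W` (`x ∈ W`) be "classes"
(`x ∈ cls x`, and `cls y = cls x` for `y ∈ cls x`) and `A ⊆ W`. If for each `x ∈ A` the sum of
`f` over `A ∩ cls x` is `≥ −#(cls x) · c` (`c ≥ 0`), then `∑_A f ≥ −#W · c`. [folklore] -/
theorem neg_card_mul_le_sum_of_classes {α : Type*} [DecidableEq α] (cls : α → Finset α)
    (f : α → ℝ) {c : ℝ} (hc : 0 ≤ c) : ∀ (W A : Finset α), A ⊆ W → (∀ x ∈ W, cls x ⊆ W) →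
      (∀ x ∈ W, x ∈ cls x) → (∀ x ∈ W, ∀ y ∈ cls x, cls y = cls x) →
      (∀ x ∈ A, -(((cls x).card : ℝ) * c) ≤ ∑ y ∈ A ∩ cls x, f y) →
      -((W.card : ℝ) * c) ≤ ∑ x ∈ A, f x := by
  intro W
  induction W using Finset.strongInduction with
  | H W ih =>
    intro A hAW hclsW hself hcls hbound
    rcases A.eq_empty_or_nonempty with rfl | ⟨x, hx⟩
    · rw [Finset.sum_empty, neg_nonpos]
      positivity
    have hxW := hAW hx
    set O := cls x with hO
    have hOW : O ⊆ W := hclsW x hxW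
    have hxO : x ∈ O := hself x hxW
    -- classes of points outside `O` avoid `O`
    have hdisj : ∀ y ∈ W \ O, Disjoint (cls y) O := by
      intro y hy
      rw [Finset.mem_sdiff] at hy
      refine Finset.disjoint_left.mpr fun z hz hzO => hy.2 ?_
      have h1 : cls z = cls y := hcls y hy.1 z hz
      have h2 : cls z = O := hcls x hxW z hzO
      rw [← h2, h1]
      exact hself y hy.1
    have hsplit : ∑ y ∈ A, f y = ∑ y ∈ A ∩ O, f y + ∑ y ∈ A \ O, f y :=
      (Finset.sum_inter_add_sum_sdiff A O f).symm
    have h1 : -((O.card : ℝ) * c) ≤ ∑ y ∈ A ∩ O, f y := hbound x hx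
    have hlt : W \ O ⊂ W := Finset.sdiff_ssubset hOW ⟨x, hxO⟩
    have h2 : -(((W \ O).card : ℝ) * c) ≤ ∑ y ∈ A \ O, f y := by
      refine ih (W \ O) hlt (A \ O) (Finset.sdiff_subset_sdiff hAW subset_rfl) ?_ ?_ ?_ ?_
      · intro y hy z hz
        exact Finset.mem_sdiff.mpr ⟨hclsW y (Finset.mem_sdiff.mp hy).1 hz,
          Finset.disjoint_left.mp (hdisj y hy) hz⟩
      · intro y hy
        exact hself y (Finset.mem_sdiff.mp hy).1
      · intro y hy z hz
        exact hcls y (Finset.mem_sdiff.mp hy).1 z hz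
      · intro y hy
        have hyW : y ∈ W \ O := Finset.sdiff_subset_sdiff hAW subset_rfl hy
        have : (A \ O) ∩ cls y = A ∩ cls y := by
          ext z
          simp only [Finset.mem_inter, Finset.mem_sdiff]
          exact ⟨fun h => ⟨h.1.1, h.2⟩,
            fun h => ⟨⟨h.1, Finset.disjoint_left.mp (hdisj y hyW) h.2⟩, h.2⟩⟩
        rw [this]
        exact hbound y (Finset.mem_sdiff.mp hy).1
    have hcardW : ((W \ O).card : ℝ) = W.card - O.card := by
      rw [Finset.card_sdiff_of_subset hOW, Nat.cast_sub (Finset.card_le_card hOW)]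
    rw [hcardW] at h2
    rw [hsplit]
    linarith

/-! ### Proposition 12 in sum form -/

/-- **Stub H — Proposition 12 in its printed SUM form** (the tree has the singleton case
`AlgPt.liouville_conj`): for two classes `conj P`, `conj P'` and ANY finite set `A` of pairs of
DISTINCT points `(q, q') ∈ conj P × conj P'`,
`∑_{(q,q') ∈ A} log dist(q, q') ≥ −(log 2 · deg P · deg P' + deg P · ht P' + deg P' · ht P)` — the
same budget as for one pair. Proof as printed: decompose `conj P × conj P'` into Galois orbits (the
orbit of `(embPt φ, embPt φ')` is the image of the embeddings of the compositum `L` of the two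
embedded fields, injectively), apply the tree's diophantine core
`neg_logHeight_le_sum_log_projDist` (any finite set of embeddings of `L`) on each orbit with the
embeddings whose pair lies in `A`, use `logHeight = [L:ℚ] · h_abs` and `∑_O |O| ≤ deg P · deg P'`.
[cite: NguyenRoy2016, Proposition 12] -/
theorem stub_liouvilleConjSum (P P' : AlgPt) (A : Finset (PPt × PPt))
    (hA : ∀ x ∈ A, x.1 ∈ P.conj ∧ x.2 ∈ P'.conj ∧ x.1 ≠ x.2) :
    -(Real.log 2 * P.deg * P'.deg + P.deg * P'.ht + P'.deg * P.ht) ≤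
      ∑ x ∈ A, Real.log (pdist x.1 x.2) := by
  -- pairs of points of `conj P × conj P'` ↔ pairs of embeddings
  let pt : (Kp P.1 →ₐ[ℚ] ℂ) × (Kp P'.1 →ₐ[ℚ] ℂ) → PPt × PPt := fun i => (P.embPt i.1, P'.embPt i.2)
  have hinj : Function.Injective pt := fun i i' h =>
    Prod.ext (P.embPt_injective (congrArg Prod.fst h)) (P'.embPt_injective (congrArg Prod.snd h))
  set A' : Finset ((Kp P.1 →ₐ[ℚ] ℂ) × (Kp P'.1 →ₐ[ℚ] ℂ)) := univ.filter fun i => pt i ∈ A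
    with hA'def
  let g : (Kp P.1 →ₐ[ℚ] ℂ) × (Kp P'.1 →ₐ[ℚ] ℂ) → ℝ := fun i => Real.log (pdist (pt i).1 (pt i).2)
  have hsum : ∑ x ∈ A, Real.log (pdist x.1 x.2) = ∑ i ∈ A', g i := by
    have hAeq : A = A'.image pt := by
      ext x
      simp only [hA'def, Finset.mem_image, Finset.mem_filter, Finset.mem_univ, true_and]
      refine ⟨fun hx => ?_, fun ⟨i, hi, hix⟩ => hix ▸ hi⟩
      obtain ⟨h1, h2, -⟩ := hA x hx
      obtain ⟨φ, -, hφ⟩ := Finset.mem_image.mp h1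
      obtain ⟨φ', -, hφ'⟩ := Finset.mem_image.mp h2
      have hx' : pt (φ, φ') = x := Prod.ext hφ hφ'
      exact ⟨(φ, φ'), hx'.symm ▸ hx, hx'⟩
    rw [hAeq, Finset.sum_image fun i _ i' _ h => hinj h]
  rw [hsum]
  -- the compositum of a pair of embeddings and the action of its embeddings on pairs
  let Lc : (Kp P.1 →ₐ[ℚ] ℂ) × (Kp P'.1 →ₐ[ℚ] ℂ) → IntermediateField ℚ ℂ := fun i =>
    IntermediateField.adjoin ℚ
      (Set.range (fun j => i.1 (ap P.1 j)) ∪ Set.range (fun j => i.2 (ap P'.1 j)))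
  haveI hNF : ∀ i, NumberField (Lc i) := fun i => numberField_adjoin_pair P P' i.1 i.2
  let f : ∀ i : (Kp P.1 →ₐ[ℚ] ℂ) × (Kp P'.1 →ₐ[ℚ] ℂ), Kp P.1 →+* Lc i := fun i =>
    i.1.toRingHom.codRestrict (Lc i) (map_mem_adjoin_pair P P' i.1 i.2).1
  let f' : ∀ i : (Kp P.1 →ₐ[ℚ] ℂ) × (Kp P'.1 →ₐ[ℚ] ℂ), Kp P'.1 →+* Lc i := fun i =>
    i.2.toRingHom.codRestrict (Lc i) (map_mem_adjoin_pair P P' i.1 i.2).2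
  let act : ∀ i : (Kp P.1 →ₐ[ℚ] ℂ) × (Kp P'.1 →ₐ[ℚ] ℂ),
      (Lc i →+* ℂ) → (Kp P.1 →ₐ[ℚ] ℂ) × (Kp P'.1 →ₐ[ℚ] ℂ) := fun i σ =>
    ((σ.comp (f i)).toRatAlgHom, (σ.comp (f' i)).toRatAlgHom)
  let cls : (Kp P.1 →ₐ[ℚ] ℂ) × (Kp P'.1 →ₐ[ℚ] ℂ) →
      Finset ((Kp P.1 →ₐ[ℚ] ℂ) × (Kp P'.1 →ₐ[ℚ] ℂ)) := fun i => univ.image (act i)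
  -- orbits: size `[L:ℚ]`, and equal or disjoint
  have hact_inj : ∀ i, Function.Injective (act i) := fun i =>
    pairOrbit_act_injective P P' (L := Lc i) rfl (f i) (f' i) (fun x hx => hx)
  have hcard : ∀ i, (cls i).card = finrank ℚ (Lc i) := fun i => by
    show (univ.image (act i)).card = _
    rw [Finset.card_image_of_injective _ (hact_inj i), Finset.card_univ,
      NumberField.Embeddings.card]
  have hself : ∀ i, i ∈ cls i := fun i =>
    Finset.mem_image.mpr ⟨algebraMap (Lc i) ℂ, Finset.mem_univ _,
      Prod.ext (AlgHom.ext fun _ => rfl) (AlgHom.ext fun _ => rfl)⟩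
  have hcls : ∀ i, ∀ i' ∈ cls i, cls i' = cls i := by
    intro i i' hi'
    obtain ⟨σ, -, rfl⟩ := Finset.mem_image.mp hi'
    have hσ : ∀ z, σ z ∈ Lc (act i σ) := by
      refine ringHom_map_mem_of_gens (K := Lc i) rfl σ ?_
      rintro _ (⟨j, rfl⟩ | ⟨j, rfl⟩)
      · exact IntermediateField.subset_adjoin ℚ _ (Or.inl ⟨j, rfl⟩)
      · exact IntermediateField.subset_adjoin ℚ _ (Or.inr ⟨j, rfl⟩)
    have hsub : cls (act i σ) ⊆ cls i := by
      intro k hk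
      obtain ⟨τ, -, rfl⟩ := Finset.mem_image.mp hk
      obtain ⟨ρ, h1, h2⟩ := pairOrbit_act_transport σ hσ (f i) (f' i) (f (act i σ))
        (f' (act i σ)) (fun _ => rfl) (fun _ => rfl) τ
      exact Finset.mem_image.mpr ⟨ρ, Finset.mem_univ _, Prod.ext h1 h2⟩
    refine Finset.eq_of_subset_of_card_le hsub ?_
    rw [hcard, hcard]
    exact finrank_le_of_ringHom_mem σ hσ
  -- Liouville on each orbit
  have hc : 0 ≤ habs P.1 + habs P'.1 + Real.log 2 :=
    add_nonneg (add_nonneg (habs_nonneg _) (habs_nonneg _)) (Real.log_nonneg one_le_two)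
  have main : -(((univ : Finset ((Kp P.1 →ₐ[ℚ] ℂ) × (Kp P'.1 →ₐ[ℚ] ℂ))).card : ℝ) *
      (habs P.1 + habs P'.1 + Real.log 2)) ≤ ∑ i ∈ A', g i := by
    refine neg_card_mul_le_sum_of_classes cls g hc univ A' (Finset.subset_univ _)
      (fun i _ => Finset.subset_univ _) (fun i _ => hself i) (fun i _ i' hi' => hcls i i' hi') ?_
    intro i hi
    have hiA : pt i ∈ A := by
      rw [hA'def, Finset.mem_filter] at hi
      exact hi.2
    have hγ : (fun j => f i (ap P.1 j)) ≠ 0 := fun h => by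
      simpa [ap_piv] using congrFun h (piv P.1)
    have hδ : (fun j => f' i (ap P'.1 j)) ≠ 0 := fun h => by
      simpa [ap_piv] using congrFun h (piv P'.1)
    have hw : wedge (fun j => f i (ap P.1 j)) (fun j => f' i (ap P'.1 j)) ≠ 0 :=
      wedge_ne_zero_of_mk_ne hγ hδ (hA _ hiA).2.2
    let S : Finset (Lc i →+* ℂ) := univ.filter fun σ => act i σ ∈ A'
    have hSA : ∀ σ ∈ S, pt (act i σ) ∈ A := fun σ hσ => by
      have := (Finset.mem_filter.mp hσ).2
      rw [hA'def, Finset.mem_filter] at this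
      exact this.2
    have hL := pairOrbit_liouville (Lc i) hγ hδ hw S fun σ hσ => (hA _ (hSA σ hσ)).2.2
    have e1 : habs (Projectivization.mk ℂ
        (fun j => algebraMap (Lc i) ℂ ((fun j => f i (ap P.1 j)) j)) (map_vec_ne_zero _ hγ)) =
        habs P.1 :=
      P.habs_of_mem_conj (Finset.mem_image_of_mem _ (Finset.mem_univ i.1))
    have e2 : habs (Projectivization.mk ℂ
        (fun j => algebraMap (Lc i) ℂ ((fun j => f' i (ap P'.1 j)) j)) (map_vec_ne_zero _ hδ)) =
        habs P'.1 :=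
      P'.habs_of_mem_conj (Finset.mem_image_of_mem _ (Finset.mem_univ i.2))
    have hfilt : A' ∩ cls i = S.image (act i) := by
      ext k
      simp only [S, cls, Finset.mem_inter, Finset.mem_filter, Finset.mem_image, Finset.mem_univ,
        true_and]
      constructor
      · rintro ⟨hk, σ, rfl⟩
        exact ⟨σ, hk, rfl⟩
      · rintro ⟨σ, hσ, rfl⟩
        exact ⟨hσ, σ, rfl⟩
    rw [e1, e2] at hL
    rw [hfilt, Finset.sum_image fun σ _ τ _ h => hact_inj i h, hcard i]
    exact hL
  have hcardI : ((univ : Finset ((Kp P.1 →ₐ[ℚ] ℂ) × (Kp P'.1 →ₐ[ℚ] ℂ))).card : ℝ) =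
      P.deg * P'.deg := by
    rw [Finset.card_univ, Fintype.card_prod, AlgHom.card ℚ (Kp P.1) ℂ, AlgHom.card ℚ (Kp P'.1) ℂ,
      Nat.cast_mul]
    rfl
  rw [hcardI] at main
  have e : (P.deg : ℝ) * P'.deg * (habs P.1 + habs P'.1 + Real.log 2) =
      Real.log 2 * P.deg * P'.deg + P.deg * P'.ht + P'.deg * P.ht := by
    rw [AlgPt.ht, AlgPt.ht]
    ring
  linarith

end Summit.Schanuel.Schanuel.Theorems.NguyenRoySharp

end
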